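import Mathlib.Analysis.SpecialFunctions.Gamma.Deriv
import Mathlib.Analysis.SpecialFunctions.Gaussian.GaussianIntegral
import Mathlib.MeasureTheory.Integral.IntegralEqImproper
import Literature.Analysis.SpecialFunctions.GammaVerticalBounds
import HarnessLib

/-!
# Platt's Gaussian window for `Λ_χ(t)`: the Gamma-factor integral `P(t₀, h)`
# (Math. Comp. 85 (2016) §8, Lemma 8.4)

Topic `Literature/NumberTheory/LFunctions`; namespace `Literature.NumberTheory.LFunctions`, engine
sub-namespace `GaussianWindow`. Everything in this file is PROVED (no named fact, no new definition).
Typed for the parity-realchar cell (D-0088 (4) literature-typing layer, row «Platt 2016 (Math. Comp.,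
certified GRH/`L`-function computations)»): instrument provenance for the up-sampling step of Platt's
GRH verification `Literature.NumberTheory.LFunctions.platt2016_theorem71/72`
(`DirichletLRiemannHypothesisUpTo.lean`). After the sampling theorems of §8
(`CertifiedLFunctionUpsampling.lean`: Whittaker–Shannon, Weiss), Platt windows the completed
`L`-function, `W(t, χ) := Λ_χ(t) exp(-(t - t₀)²/(2h²))` (p. 3021), and needs "two preparatory lemmas"
before bounding the aliasing integral `I_χ(A)` of `W` (Lemma 8.5): Lemma 8.3 (an explicit Stirling bound
for `|Γ((1/2 + it + a_χ)/2)| e^{πt/4}`) and **Lemma 8.4**, the bound on the Gamma-factor Gaussian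
integral

  `P(t₀, h) := ∫_{-∞}^{∞} |Γ((3 + it)/2)| exp(πt/4) exp(-(t - t₀)²/(2h²)) dt`

which enters Lemma 8.5 as `I_χ(A) ≤ 2 (q/π)^{M/2} ζ(M + 1/2) exp(M²/(2h²) - πAM) P(t₀, h)/(πM)` after
the contour shift to `Re s = M + 1/2 = 3 - a_χ` (there `|Γ((s + a_χ)/2)| = |Γ((3 + it)/2)|` for both
parities).

Source: D. J. Platt, *Numerical computations concerning the GRH*, Math. Comp. **85** (2016) 3009–3027
[Platt2016GRH], §8 pp. 3021–3023 (journal pdf, AMS open access; page-checked): Lemma 8.4 p. 3021,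
proof p. 3022 (= arXiv:1305.3087v1 §6, where `P(t₀, h)` is defined inside Lemma 6.4 and bounded in
Lemma 6.5).

## Contents (all proved)

* `platt2016_lemma84` — **Lemma 8.4**: for `t₀ ≥ 0`, `h > 0`,
  `P(t₀, h) ≤ hπ (t₀ + h/√(2π) + 1 + 1/(2√2))`, the integral written out over Mathlib's
  `Complex.Gamma`; `platt2016_lemma84_integrable` — the integrand is integrable (so the Bochner
  integral in the statement is the honest one, not a junk `0`).
* Engine (`GaussianWindow.*`, the steps of the printed proof): the reflection-formula identity
  `‖Γ((3+it)/2)‖² = (1+t²)/4 · π/cosh(πt/2)` (`norm_sq_Gamma_three_half_line`, from the TREE's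
  `Literature.Analysis.SpecialFunctions.GammaVert.norm_sq_Gamma_three_halves`), the compensation
  `‖Γ((3+it)/2)‖ e^{πt/4} ≤ (1+|t|)/2 · √(2π)` for all `t` (`norm_Gamma_mul_exp_le_abs`) and Platt's
  `(1+t)/2 · √(2π)` for `t ≥ 0` (`norm_Gamma_mul_exp_le_of_nonneg`), `|Γ((3+it)/2)| ≤ Γ(3/2) = √π/2`
  (`norm_Gamma_three_half_le`, from the tree's `GammaVert.norm_Gamma_le_Gamma_re` and
  `GammaVert.Real_Gamma_three_halves_sq`), and the Gaussian moments
  `∫ e^{-(t-t₀)²/(2h²)} = h√(2π)`, `∫_{t≤0} e^{-t²/(2h²)} = h√(2π)/2`,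
  `∫_{t>0} (t - t₀) e^{-(t-t₀)²/(2h²)} = h² e^{-t₀²/(2h²)}`
  (`integral_gauss`, `integral_Iic_gauss_zero`, `integral_Ioi_sub_mul_gauss`).

## Method (the printed proof, p. 3022)

Split at `t = 0`. For `t ≤ 0`: `|Γ((3+it)/2)| ≤ Γ(3/2)`, `e^{πt/4} ≤ 1` and (since `t₀ ≥ 0`)
`e^{-(t-t₀)²/(2h²)} ≤ e^{-t²/(2h²)}`, giving `Γ(3/2) · h√(2π)/2 = hπ√2/4` (Platt keeps the factor
`1 - erf(√2 t₀/2) ≤ 1`; we bound it by `1` at once). For `t ≥ 0`: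
`|Γ((3+it)/2)| = |(1+it)/2| |Γ((1+it)/2)| ≤ (1+t)/2 · √(π/cosh(πt/2))` and
`√(π/cosh(πt/2)) e^{πt/4} ≤ √(2π)`, then `∫_0^∞ (1+t)/2 √(2π) e^{-(t-t₀)²/(2h²)} dt ≤ hπ(h/√(2π) + t₀ + 1)`
by the zeroth and first Gaussian moments. Total `hπ(t₀ + h/√(2π) + 1) + hπ√2/4`.

On the constant: the printed proof ends with `… ≤ hπ(h/√(2π) + t₀ + 1) + hπ√2/4`, and
`√2/4 = 1/(2√2)`; we state the lemma with `1/(2√2)` (a reading of the typeset statement's last term as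
`½√2` is the weaker inequality and follows a fortiori).

NOT here: Lemma 8.3 (uniform explicit Stirling for `|Γ((1/2+it+a_χ)/2)|e^{πt/4}` down to `t = 0`; the
tree's `GammaStirlingUniform` error term is too weak near `|w| = 1/4` — recorded by the g5/g7 seats),
Lemma 8.5 (needs the contour shift of the windowed `Λ_χ` and Rademacher's bound Lemma 7.3),
Lemma 8.6 (its geometric majorant `G(n+1)/G(n)` decreasing needs a hypothesis on `S, A, h` that the
printed statement leaves implicit) and Lemma 8.7 ("for large enough `t₀`").

`lean search` (2026-08-27): the Gamma identities are REUSED from the tree's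
`Literature/Analysis/SpecialFunctions/GammaVerticalBounds.lean` (`GammaVert.norm_sq_Gamma_three_halves`:
`|Γ(3/2+iy)|² = (1/4+y²)π/cosh(πy)`, `GammaVert.norm_Gamma_le_Gamma_re`: `|Γ(x+iy)| ≤ Γ(x)`,
`GammaVert.Real_Gamma_three_halves_sq`); Mathlib supplies `integral_gaussian`, `integral_gaussian_Ioi`,
`integral_comp_neg_Ioi`, `integral_Ioi_of_hasDerivAt_of_tendsto`, `Complex.continuousAt_Gamma`.
Nothing is restated.

## References

* [Platt2016GRH] D. J. Platt, *Numerical computations concerning the GRH*, Math. Comp. 85 (2016),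
  no. 302, 3009–3027, doi:10.1090/mcom/3077: §8 "Rigorous up-sampling", `W(t, χ)` and Lemmas 8.3–8.4
  p. 3021, proof of Lemma 8.4 p. 3022, Lemma 8.5 pp. 3022–3023 (arXiv:1305.3087v1 §6,
  Lemmas 6.4–6.5).
-/

noncomputable section

open Complex Filter Topology Set MeasureTheory
open Literature.Analysis.SpecialFunctions.GammaVert
open scoped Real

namespace Literature.NumberTheory.LFunctions

namespace GaussianWindow

/-! ## §1 The Gamma factor `Γ((3 + it)/2) e^{πt/4}` -/

/-- `(3 + it)/2 = 3/2 + i·(t/2)`, the format of the tree's `GammaVerticalBounds.lean`. [folklore] -/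
private theorem three_half_line_eq (t : ℝ) :
    (3 + (t : ℂ) * I) / 2 = (3 / 2 : ℂ) + ((t / 2 : ℝ) : ℂ) * I := by
  push_cast; ring

/-- **The reflection formula on the line `Re s = 3/2`:** `‖Γ((3 + it)/2)‖² = (1+t²)/4 · π/cosh(πt/2)`
(the tree's `GammaVert.norm_sq_Gamma_three_halves` at `y = t/2`: `Γ(z+1) = zΓ(z)` and
`|Γ(1/2+iy)|² = π/cosh(πy)`) — the identity behind the printed steps
"`|Γ((3+it)/2)| ≤ (1+t)/2 |Γ((1+it)/2)| ≤ (1+t)/2 √(π/cosh(πt/2))`". [cite: Platt2016GRH, Lemma 8.4 p. 3021 (proof p. 3022)] -/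
theorem norm_sq_Gamma_three_half_line (t : ℝ) :
    ‖Complex.Gamma ((3 + t * I) / 2)‖ ^ 2 = (1 + t ^ 2) / 4 * (π / Real.cosh (π * t / 2)) := by
  rw [three_half_line_eq, norm_sq_Gamma_three_halves (t / 2)]
  rw [show π * (t / 2) = π * t / 2 by ring]
  ring

/-- **Exact compensation of the Gamma decay:** `‖Γ((3+it)/2)‖ e^{πt/4} ≤ (1+|t|)/2 · √(2π)` for ALL
real `t` (`(1+t²)/4 ≤ ((1+|t|)/2)²` and `π e^{πt/2}/cosh(πt/2) ≤ 2π`) — the printed step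
"`√(π/cosh(πt/2)) exp(πt/4) ≤ √(2π)`", kept two-sided so that it also yields integrability. [cite: Platt2016GRH, Lemma 8.4 p. 3021 (proof p. 3022)] -/
theorem norm_Gamma_mul_exp_le_abs (t : ℝ) :
    ‖Complex.Gamma ((3 + t * I) / 2)‖ * Real.exp (π * t / 4) ≤
      (1 + |t|) / 2 * Real.sqrt (2 * π) := by
  have hc : 0 < Real.cosh (π * t / 2) := Real.cosh_pos _
  have hsq : (‖Complex.Gamma ((3 + t * I) / 2)‖ * Real.exp (π * t / 4)) ^ 2 ≤
      ((1 + |t|) / 2 * Real.sqrt (2 * π)) ^ 2 := by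
    rw [mul_pow, norm_sq_Gamma_three_half_line, mul_pow ((1 + |t|) / 2),
      Real.sq_sqrt (by positivity),
      show Real.exp (π * t / 4) ^ 2 = Real.exp (π * t / 2) by rw [sq, ← Real.exp_add]; ring_nf]
    have h1 : (1 + t ^ 2) / 4 ≤ ((1 + |t|) / 2) ^ 2 := by nlinarith [abs_nonneg t, sq_abs t]
    have h2 : π / Real.cosh (π * t / 2) * Real.exp (π * t / 2) ≤ 2 * π := by
      rw [div_mul_eq_mul_div, div_le_iff₀ hc]
      have : Real.exp (π * t / 2) ≤ 2 * Real.cosh (π * t / 2) := by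
        rw [Real.cosh_eq]; linarith [Real.exp_pos (-(π * t / 2))]
      nlinarith [Real.pi_pos]
    calc (1 + t ^ 2) / 4 * (π / Real.cosh (π * t / 2)) * Real.exp (π * t / 2)
        = (1 + t ^ 2) / 4 * (π / Real.cosh (π * t / 2) * Real.exp (π * t / 2)) := by ring
      _ ≤ ((1 + |t|) / 2) ^ 2 * (2 * π) := mul_le_mul h1 h2 (by positivity) (by positivity)
  exact (pow_le_pow_iff_left₀ (by positivity) (by positivity) two_ne_zero).mp hsq

/-- Platt's bound on the half-line `t ≥ 0`: `‖Γ((3+it)/2)‖ e^{πt/4} ≤ (1+t)/2 · √(2π)`. [cite: Platt2016GRH, Lemma 8.4 p. 3021 (proof p. 3022)] -/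
theorem norm_Gamma_mul_exp_le_of_nonneg {t : ℝ} (ht : 0 ≤ t) :
    ‖Complex.Gamma ((3 + t * I) / 2)‖ * Real.exp (π * t / 4) ≤
      (1 + t) / 2 * Real.sqrt (2 * π) := by
  have h := norm_Gamma_mul_exp_le_abs t
  rwa [abs_of_nonneg ht] at h

/-- `‖Γ((3+it)/2)‖ ≤ Γ(3/2) = √π/2` for all real `t` — the printed step for `t ≤ 0`, from the tree's
`GammaVert.norm_Gamma_le_Gamma_re` (`|Γ(x+iy)| ≤ Γ(x)`) and `GammaVert.Real_Gamma_three_halves_sq`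
(`Γ(3/2)² = π/4`). [cite: Platt2016GRH, Lemma 8.4 p. 3021 (proof p. 3022)] -/
theorem norm_Gamma_three_half_le (t : ℝ) :
    ‖Complex.Gamma ((3 + t * I) / 2)‖ ≤ Real.sqrt π / 2 := by
  have h := norm_Gamma_le_Gamma_re (by norm_num : (0 : ℝ) < 3 / 2) (t / 2)
  have hG : Real.Gamma (3 / 2) = Real.sqrt π / 2 := by
    have h1 : Real.sqrt (Real.Gamma (3 / 2) ^ 2) = Real.sqrt (π / 4) := by
      rw [Real_Gamma_three_halves_sq]
    rw [Real.sqrt_sq (Real.Gamma_pos_of_pos (by norm_num)).le, Real.sqrt_div Real.pi_pos.le,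
      show Real.sqrt 4 = 2 by rw [show (4 : ℝ) = 2 ^ 2 by norm_num, Real.sqrt_sq (by norm_num)]] at h1
    exact h1
  rw [three_half_line_eq]
  rw [hG, show (((3 / 2 : ℝ)) : ℂ) = 3 / 2 by push_cast; ring] at h
  exact h

/-- `t ↦ Γ((3+it)/2)` is continuous (no poles on `Re = 3/2`). [folklore] -/
private theorem continuous_Gamma_three_half_line :
    Continuous fun t : ℝ => Complex.Gamma ((3 + t * I) / 2) := by
  have hc : Continuous fun t : ℝ => ((3 + t * I) / 2 : ℂ) := by fun_prop
  refine continuous_iff_continuousAt.mpr fun t => ?_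
  refine (Complex.continuousAt_Gamma _ fun m => ?_).comp hc.continuousAt
  intro h
  have := congrArg Complex.re h
  simp at this
  linarith

/-! ## §2 The Gaussian window and its moments -/

/-- `exp(-(t-t₀)²/(2h²)) = exp(-b (t-t₀)²)` with `b = 1/(2h²)` (Mathlib's Gaussian normal form).
[folklore] -/
private theorem gauss_eq (h t₀ t : ℝ) :
    Real.exp (-(t - t₀) ^ 2 / (2 * h ^ 2)) = Real.exp (-(1 / (2 * h ^ 2)) * (t - t₀) ^ 2) := by
  congr 1; ring

/-- The shifted Gaussian window `exp(-(t-t₀)²/(2h²))` is integrable (`h > 0`). [folklore] -/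
private theorem integrable_gauss {h : ℝ} (hh : 0 < h) (t₀ : ℝ) :
    Integrable fun t : ℝ => Real.exp (-(t - t₀) ^ 2 / (2 * h ^ 2)) := by
  have hb : 0 < 1 / (2 * h ^ 2) := by positivity
  have := (integrable_exp_neg_mul_sq hb).comp_sub_right t₀
  refine this.congr (ae_of_all _ fun t => ?_)
  simp only [gauss_eq]

/-- The first moment `(t - t₀) exp(-(t-t₀)²/(2h²))` of the window is integrable (`h > 0`).
[folklore] -/
private theorem integrable_sub_mul_gauss {h : ℝ} (hh : 0 < h) (t₀ : ℝ) :
    Integrable fun t : ℝ => (t - t₀) * Real.exp (-(t - t₀) ^ 2 / (2 * h ^ 2)) := by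
  have hb : 0 < 1 / (2 * h ^ 2) := by positivity
  have := (integrable_mul_exp_neg_mul_sq hb).comp_sub_right t₀
  refine this.congr (ae_of_all _ fun t => ?_)
  simp only [gauss_eq]

/-- **Zeroth moment of the window:** `∫ exp(-(t-t₀)²/(2h²)) dt = h√(2π)` — the printed
`∫_0^∞ … exp(-(t-t₀)²/(2h²)) dt ≤ h√(2π)(…)` step. [cite: Platt2016GRH, Lemma 8.4 p. 3021 (proof p. 3022)] -/
theorem integral_gauss {h : ℝ} (hh : 0 < h) (t₀ : ℝ) :
    ∫ t : ℝ, Real.exp (-(t - t₀) ^ 2 / (2 * h ^ 2)) = h * Real.sqrt (2 * π) := by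
  have e : (fun t : ℝ => Real.exp (-(t - t₀) ^ 2 / (2 * h ^ 2))) =
      fun t => (fun u : ℝ => Real.exp (-(1 / (2 * h ^ 2)) * u ^ 2)) (t - t₀) := by
    funext t; simp only [gauss_eq]
  rw [e, integral_sub_right_eq_self (fun u : ℝ => Real.exp (-(1 / (2 * h ^ 2)) * u ^ 2)) t₀,
    integral_gaussian]
  rw [show π / (1 / (2 * h ^ 2)) = (h * Real.sqrt (2 * π)) ^ 2 by
    rw [mul_pow, Real.sq_sqrt (by positivity)]; field_simp]
  exact Real.sqrt_sq (by positivity)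

/-- **Half of the centred window:** `∫_{t ≤ 0} exp(-t²/(2h²)) dt = h√(2π)/2` — the printed
"`Γ(3/2) · h√(2π)/2 · (1 - erf(√2 t₀/2)) ≤ Γ(3/2) h√(2π)/2`" step (we majorise the shifted window on
`t ≤ 0 ≤ t₀` by the centred one instead of carrying the error function). [cite: Platt2016GRH, Lemma 8.4 p. 3021 (proof p. 3022)] -/
theorem integral_Iic_gauss_zero {h : ℝ} (hh : 0 < h) :
    ∫ t in Iic (0 : ℝ), Real.exp (-(1 / (2 * h ^ 2)) * t ^ 2) = h * Real.sqrt (2 * π) / 2 := by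
  have e := integral_comp_neg_Ioi 0 (fun t : ℝ => Real.exp (-(1 / (2 * h ^ 2)) * t ^ 2))
  simp only [neg_zero, even_two.neg_pow] at e
  rw [← e, integral_gaussian_Ioi]
  rw [show π / (1 / (2 * h ^ 2)) = (h * Real.sqrt (2 * π)) ^ 2 by
    rw [mul_pow, Real.sq_sqrt (by positivity)]; field_simp, Real.sqrt_sq (by positivity)]

/-- **First moment on the right half-line:**
`∫_{t>0} (t - t₀) exp(-(t-t₀)²/(2h²)) dt = h² exp(-t₀²/(2h²))` (fundamental theorem of calculus on
`(0, ∞)` with the primitive `-h² exp(-(t-t₀)²/(2h²))`) — the source of the `h/√(2π)` term in Lemma 8.4.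
[cite: Platt2016GRH, Lemma 8.4 p. 3021 (proof p. 3022)] -/
theorem integral_Ioi_sub_mul_gauss {h : ℝ} (hh : 0 < h) (t₀ : ℝ) :
    ∫ t in Ioi (0 : ℝ), (t - t₀) * Real.exp (-(t - t₀) ^ 2 / (2 * h ^ 2)) =
      h ^ 2 * Real.exp (-t₀ ^ 2 / (2 * h ^ 2)) := by
  have hderiv : ∀ t : ℝ, HasDerivAt (fun x : ℝ => -h ^ 2 * Real.exp (-(x - t₀) ^ 2 / (2 * h ^ 2)))
      ((t - t₀) * Real.exp (-(t - t₀) ^ 2 / (2 * h ^ 2))) t := by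
    intro t
    have h1 : HasDerivAt (fun x : ℝ => -(x - t₀) ^ 2 / (2 * h ^ 2))
        (-(((2 : ℕ) : ℝ) * (t - t₀) ^ (2 - 1) * 1) / (2 * h ^ 2)) t :=
      (((hasDerivAt_id' t).sub_const t₀).pow 2).neg.div_const (2 * h ^ 2)
    have h2 := (h1.exp).const_mul (-h ^ 2)
    have hv : -h ^ 2 * (Real.exp (-(t - t₀) ^ 2 / (2 * h ^ 2)) *
        (-(((2 : ℕ) : ℝ) * (t - t₀) ^ (2 - 1) * 1) / (2 * h ^ 2))) =
        (t - t₀) * Real.exp (-(t - t₀) ^ 2 / (2 * h ^ 2)) := by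
      have hne : (2 : ℝ) * h ^ 2 ≠ 0 := by positivity
      field_simp
      ring
    rw [hv] at h2
    exact h2
  have hcont : ContinuousWithinAt (fun x : ℝ => -h ^ 2 * Real.exp (-(x - t₀) ^ 2 / (2 * h ^ 2)))
      (Ici 0) 0 := (hderiv 0).continuousAt.continuousWithinAt
  have hlim : Tendsto (fun x : ℝ => -h ^ 2 * Real.exp (-(x - t₀) ^ 2 / (2 * h ^ 2)))
      atTop (𝓝 0) := by
    have h1 : Tendsto (fun t : ℝ => -(t - t₀) ^ 2 / (2 * h ^ 2)) atTop atBot := by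
      have ha : Tendsto (fun t : ℝ => (t - t₀) ^ 2) atTop atTop :=
        (tendsto_pow_atTop two_ne_zero).comp (tendsto_atTop_add_const_right _ (-t₀) tendsto_id)
      have hb : Tendsto (fun t : ℝ => (t - t₀) ^ 2 / (2 * h ^ 2)) atTop atTop :=
        ha.atTop_div_const (by positivity)
      have hc := tendsto_neg_atTop_atBot.comp hb
      refine hc.congr fun t => ?_
      simp only [Function.comp]
      ring
    have h2 := Real.tendsto_exp_atBot.comp h1
    have h3 := h2.const_mul (-h ^ 2)
    simpa using h3
  have hint := (integrable_sub_mul_gauss hh t₀).integrableOn (s := Ioi 0)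
  rw [integral_Ioi_of_hasDerivAt_of_tendsto hcont (fun t _ => hderiv t) hint hlim]
  simp

end GaussianWindow

open GaussianWindow

/-! ## §3 Lemma 8.4: `P(t₀, h) ≤ hπ (t₀ + h/√(2π) + 1 + 1/(2√2))` -/

/-- **The integrand of `P(t₀, h)` is integrable** (`h > 0`, any `t₀`): it is continuous and majorised by
`√(2π)/2 · (1 + |t|) exp(-(t-t₀)²/(2h²))` (`GaussianWindow.norm_Gamma_mul_exp_le_abs`). Hence the Bochner
integral in `platt2016_lemma84` is the genuine value of Platt's `P(t₀, h)`.
[cite: Platt2016GRH, Lemma 8.4 p. 3021] -/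
theorem platt2016_lemma84_integrable (t₀ : ℝ) {h : ℝ} (hh : 0 < h) :
    Integrable fun t : ℝ => ‖Complex.Gamma ((3 + t * I) / 2)‖ * Real.exp (π * t / 4) *
      Real.exp (-(t - t₀) ^ 2 / (2 * h ^ 2)) := by
  have hg := integrable_gauss hh t₀
  have htg : Integrable fun t : ℝ => t * Real.exp (-(t - t₀) ^ 2 / (2 * h ^ 2)) := by
    have := (integrable_sub_mul_gauss hh t₀).add (hg.const_mul t₀)
    exact this.congr (ae_of_all _ fun t => by simp only [Pi.add_apply]; ring)
  have habs : Integrable fun t : ℝ => |t| * Real.exp (-(t - t₀) ^ 2 / (2 * h ^ 2)) := by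
    refine htg.norm.congr (ae_of_all _ fun t => ?_)
    simp only [Real.norm_eq_abs, abs_mul, abs_of_pos (Real.exp_pos _)]
  have hM : Integrable fun t : ℝ => Real.sqrt (2 * π) / 2 *
      (Real.exp (-(t - t₀) ^ 2 / (2 * h ^ 2)) + |t| * Real.exp (-(t - t₀) ^ 2 / (2 * h ^ 2))) :=
    (hg.add habs).const_mul _
  have hcont : Continuous fun t : ℝ => ‖Complex.Gamma ((3 + t * I) / 2)‖ * Real.exp (π * t / 4) *
      Real.exp (-(t - t₀) ^ 2 / (2 * h ^ 2)) :=
    (continuous_Gamma_three_half_line.norm.mul (by fun_prop)).mul (by fun_prop)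
  refine hM.mono' hcont.aestronglyMeasurable (ae_of_all _ fun t => ?_)
  rw [Real.norm_of_nonneg (by positivity)]
  have hG := norm_Gamma_mul_exp_le_abs t
  have hgpos : 0 < Real.exp (-(t - t₀) ^ 2 / (2 * h ^ 2)) := Real.exp_pos _
  calc ‖Complex.Gamma ((3 + t * I) / 2)‖ * Real.exp (π * t / 4) *
        Real.exp (-(t - t₀) ^ 2 / (2 * h ^ 2))
      ≤ (1 + |t|) / 2 * Real.sqrt (2 * π) * Real.exp (-(t - t₀) ^ 2 / (2 * h ^ 2)) :=
        mul_le_mul_of_nonneg_right hG hgpos.le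
    _ = Real.sqrt (2 * π) / 2 * (Real.exp (-(t - t₀) ^ 2 / (2 * h ^ 2)) +
        |t| * Real.exp (-(t - t₀) ^ 2 / (2 * h ^ 2))) := by ring

/-- **Platt 2016, Lemma 8.4 (Math. Comp. 85, p. 3021; proof p. 3022; arXiv:1305.3087v1 Lemma 6.5), as
printed:** "Let `t₀ ≥ 0`, `h > 0` and define
`P(t₀, h) := ∫_{-∞}^{∞} |Γ((3 + it)/2)| exp(πt/4) exp(-(t - t₀)²/(2h²)) dt`.
Then `P(t₀, h) ≤ hπ (t₀ + h/√(2π) + 1 + 1/(2√2))`."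
`P(t₀, h)` is written out as the Bochner integral over `ℝ` of the (integrable,
`platt2016_lemma84_integrable`) integrand, `Γ` = Mathlib's `Complex.Gamma`. The last constant is the
`hπ√2/4` with which the printed proof ends (`√2/4 = 1/(2√2)`); should the typeset statement be read as
`½√2`, that weaker bound follows from this one. Proof = the printed one (see the module docstring):
split at `t = 0`; `|Γ((3+it)/2)| ≤ Γ(3/2)`, `e^{πt/4} ≤ 1`, `(t-t₀)² ≥ t²` on `t ≤ 0`;
`|Γ((3+it)/2)| e^{πt/4} ≤ (1+t)/2 · √(2π)` on `t ≥ 0` (`|Γ((1+it)/2)|² = π/cosh(πt/2)`); then the Gaussian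
moments. This `P(t₀, h)` is the Gamma-side factor of the aliasing bound `I_χ(A)` (Lemma 8.5) for the
window `W(t, χ) = Λ_χ(t) e^{-(t-t₀)²/(2h²)}` fed to the Whittaker–Shannon/Weiss up-sampling
(`platt2016_theorem81/82`). [cite: Platt2016GRH, Lemma 8.4 p. 3021] -/
theorem platt2016_lemma84 {t₀ h : ℝ} (ht₀ : 0 ≤ t₀) (hh : 0 < h) :
    ∫ t : ℝ, ‖Complex.Gamma ((3 + t * I) / 2)‖ * Real.exp (π * t / 4) *
        Real.exp (-(t - t₀) ^ 2 / (2 * h ^ 2)) ≤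
      h * π * (t₀ + h / Real.sqrt (2 * π) + 1 + 1 / (2 * Real.sqrt 2)) := by
  set f : ℝ → ℝ := fun t => ‖Complex.Gamma ((3 + t * I) / 2)‖ * Real.exp (π * t / 4) *
    Real.exp (-(t - t₀) ^ 2 / (2 * h ^ 2)) with hf
  set g : ℝ → ℝ := fun t => Real.exp (-(t - t₀) ^ 2 / (2 * h ^ 2)) with hg
  have hfi : Integrable f := platt2016_lemma84_integrable t₀ hh
  have hgi : Integrable g := integrable_gauss hh t₀
  have htg : Integrable fun t : ℝ => t * g t := by
    have := (integrable_sub_mul_gauss hh t₀).add (hgi.const_mul t₀)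
    exact this.congr (ae_of_all _ fun t => by simp only [Pi.add_apply, hg]; ring)
  have hb : 0 < 1 / (2 * h ^ 2) := by positivity
  -- split at `t = 0`
  rw [← intervalIntegral.integral_Iic_add_Ioi hfi.integrableOn hfi.integrableOn]
  -- the half-line `t ≤ 0`: `|Γ((3+it)/2)| ≤ Γ(3/2)`, `e^{πt/4} ≤ 1`, `(t - t₀)² ≥ t²`
  have hL : ∫ t in Iic (0 : ℝ), f t ≤ Real.sqrt π / 2 * (h * Real.sqrt (2 * π) / 2) := by
    have h1 : ∫ t in Iic (0 : ℝ), f t ≤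
        ∫ t in Iic (0 : ℝ), Real.sqrt π / 2 * Real.exp (-(1 / (2 * h ^ 2)) * t ^ 2) := by
      refine setIntegral_mono_on hfi.integrableOn
        ((integrable_exp_neg_mul_sq hb).const_mul _).integrableOn measurableSet_Iic fun t ht => ?_
      have ht : t ≤ 0 := ht
      have a1 := norm_Gamma_three_half_le t
      have a2 : Real.exp (π * t / 4) ≤ 1 := by
        rw [Real.exp_le_one_iff]; nlinarith [Real.pi_pos]
      have a3 : g t ≤ Real.exp (-(1 / (2 * h ^ 2)) * t ^ 2) := by
        simp only [hg]
        rw [gauss_eq, Real.exp_le_exp]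
        have : t ^ 2 ≤ (t - t₀) ^ 2 := by nlinarith
        have hb' : 0 ≤ 1 / (2 * h ^ 2) := hb.le
        nlinarith [mul_le_mul_of_nonneg_left this hb']
      calc f t = (‖Complex.Gamma ((3 + t * I) / 2)‖ * Real.exp (π * t / 4)) * g t := by
            simp only [hf, hg]
        _ ≤ (Real.sqrt π / 2 * 1) * Real.exp (-(1 / (2 * h ^ 2)) * t ^ 2) :=
            mul_le_mul (mul_le_mul a1 a2 (by positivity) (by positivity)) a3 (by positivity)
              (by positivity)
        _ = Real.sqrt π / 2 * Real.exp (-(1 / (2 * h ^ 2)) * t ^ 2) := by ring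
    refine h1.trans (le_of_eq ?_)
    rw [integral_const_mul, integral_Iic_gauss_zero hh]
  -- the half-line `t > 0`: `|Γ((3+it)/2)| e^{πt/4} ≤ (1+t)/2 √(2π)`
  have hR : ∫ t in Ioi (0 : ℝ), f t ≤
      Real.sqrt (2 * π) / 2 * (h * Real.sqrt (2 * π) + (h ^ 2 + t₀ * (h * Real.sqrt (2 * π)))) := by
    have h1 : ∫ t in Ioi (0 : ℝ), f t ≤
        ∫ t in Ioi (0 : ℝ), Real.sqrt (2 * π) / 2 * (g t + t * g t) := by
      refine setIntegral_mono_on hfi.integrableOn ((hgi.add htg).const_mul _).integrableOn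
        measurableSet_Ioi fun t ht => ?_
      have ht : 0 < t := ht
      have a1 := norm_Gamma_mul_exp_le_of_nonneg ht.le
      calc f t = (‖Complex.Gamma ((3 + t * I) / 2)‖ * Real.exp (π * t / 4)) * g t := by
            simp only [hf, hg]
        _ ≤ ((1 + t) / 2 * Real.sqrt (2 * π)) * g t :=
            mul_le_mul_of_nonneg_right a1 (by positivity)
        _ = Real.sqrt (2 * π) / 2 * (g t + t * g t) := by ring
    have h2 : ∫ t in Ioi (0 : ℝ), Real.sqrt (2 * π) / 2 * (g t + t * g t) =
        Real.sqrt (2 * π) / 2 * ((∫ t in Ioi (0 : ℝ), g t) + ∫ t in Ioi (0 : ℝ), t * g t) := by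
      rw [integral_const_mul, integral_add hgi.integrableOn htg.integrableOn]
    have h3 : ∫ t in Ioi (0 : ℝ), g t ≤ h * Real.sqrt (2 * π) :=
      (setIntegral_le_integral hgi (ae_of_all _ fun t => (Real.exp_pos _).le)).trans
        (le_of_eq (integral_gauss hh t₀))
    have h4 : ∫ t in Ioi (0 : ℝ), t * g t ≤ h ^ 2 + t₀ * (h * Real.sqrt (2 * π)) := by
      have e : ∫ t in Ioi (0 : ℝ), t * g t =
          (∫ t in Ioi (0 : ℝ), (t - t₀) * g t) + t₀ * ∫ t in Ioi (0 : ℝ), g t := by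
        rw [← integral_const_mul, ← integral_add (integrable_sub_mul_gauss hh t₀).integrableOn
          (hgi.const_mul t₀).integrableOn]
        congr 1
        funext t
        ring
      rw [e]
      simp only [hg]
      rw [integral_Ioi_sub_mul_gauss hh t₀]
      have h5 : h ^ 2 * Real.exp (-t₀ ^ 2 / (2 * h ^ 2)) ≤ h ^ 2 := by
        refine mul_le_of_le_one_right (by positivity) ?_
        rw [Real.exp_le_one_iff]
        have : 0 ≤ t₀ ^ 2 / (2 * h ^ 2) := by positivity
        rw [neg_div]; linarith
      exact add_le_add h5 (mul_le_mul_of_nonneg_left h3 ht₀)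
    calc ∫ t in Ioi (0 : ℝ), f t ≤ _ := h1
      _ = _ := h2
      _ ≤ Real.sqrt (2 * π) / 2 *
            (h * Real.sqrt (2 * π) + (h ^ 2 + t₀ * (h * Real.sqrt (2 * π)))) :=
          mul_le_mul_of_nonneg_left (add_le_add h3 h4) (by positivity)
  -- the constants
  have hA : Real.sqrt (2 * π) * Real.sqrt (2 * π) = 2 * π := Real.mul_self_sqrt (by positivity)
  have hB : Real.sqrt π * Real.sqrt (2 * π) = Real.sqrt 2 * π := by
    rw [Real.sqrt_mul (by norm_num : (0 : ℝ) ≤ 2) π, ← mul_assoc, mul_comm (Real.sqrt π),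
      mul_assoc, Real.mul_self_sqrt Real.pi_pos.le]
  have hs2 : Real.sqrt 2 * Real.sqrt 2 = 2 := Real.mul_self_sqrt (by norm_num)
  have hs2pos : 0 < Real.sqrt 2 := by positivity
  have hs2π : 0 < Real.sqrt (2 * π) := by positivity
  have e1 : 1 / (2 * Real.sqrt 2) = Real.sqrt 2 / 4 := by
    field_simp
    linarith [hs2]
  have e2 : h / Real.sqrt (2 * π) = h * Real.sqrt (2 * π) / (2 * π) := by
    field_simp
    linarith [hA]
  rw [e1, e2]
  calc (∫ t in Iic (0 : ℝ), f t) + ∫ t in Ioi (0 : ℝ), f t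
      ≤ Real.sqrt π / 2 * (h * Real.sqrt (2 * π) / 2) +
        Real.sqrt (2 * π) / 2 * (h * Real.sqrt (2 * π) + (h ^ 2 + t₀ * (h * Real.sqrt (2 * π)))) :=
        add_le_add hL hR
    _ = h * π * (t₀ + h * Real.sqrt (2 * π) / (2 * π) + 1 + Real.sqrt 2 / 4) := by
        field_simp
        linear_combination 4 * hB + (8 * (1 + t₀)) * hA

end Literature.NumberTheory.LFunctions

end
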